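import Literature.IUT.HodgeTheaters.InitialThetaDataBadLocalFrobenioid
import Literature.IUT.HodgeTheaters.GoodLocalFrobenioidOfPlaceSlim
import Literature.IUT.HodgeTheaters.HodgeTheatersRemarksArithmeticInstances
import Literature.AlgebraicGeometry.Frobenioids.PadicFrobenioidStandardType
import Literature.AlgebraicGeometry.Frobenioids.CategoryTypesEquivalenceTransport
import Literature.AnabelianGeometry.SemiGraphs.CosetCategoriesSlimTempered
import HarnessLib

/-!
# [IUTchI] Example 3.2 (iv)(v): the GENUINE `C⊢_v̲` and the `Θ`-side `C^Θ_v` ARE `p_v`-adic Frobenioids in the sense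
# of [FrdII] — Frobenioids of standard type over slim bases of FSM-type — and Remark 3.2.2 at the genuine datum
# (proof-only)

Mochizuki, *Inter-universal Teichmüller Theory I*, kurims manuscript (May 2020), Example 3.2 (iv) p. 71 ("determines
a `p_v`-adic Frobenioid with base category given by `D⊢_v` [cf. [FrdII], Example 1.1, (ii)] `C⊢_v`"), (v) p. 72 ("a
`p_v`-adic Frobenioid with base category given by `D^Θ_v` [cf. [FrdII], Example 1.1, (ii)] `C^Θ_v`") and Remark 3.2.2
p. 74 ("although the submonoid `Φ_{C⊢_v}` is not 'absolutely primitive' in the sense of [FrdII], Example 1.1, (ii), it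
is 'very close to being absolutely primitive', in the sense that … there exists a positive integer `N` such that
`N·Φ_{C⊢_v}` is absolutely primitive … the theory of [FrdII] may be applied")
[cite: Mochizuki2012, I Ex 3.2 (iv)(v) pp.71-74] (D-0012 claim key, status disputed; nothing of the series is asserted).

PROOF-ONLY (0 definitions). For the constructions of `BadLocalFrobenioidDash.lean` / `InitialThetaDataBadLocalFrobenioid.lean`
(abc-iut-L5-t2) the [FrdII] theory applies IN THE KERNEL, by the L1 theorems consumed BY NAME:
* `GaloisValDatum.dashDatum_isFrobenioid / _isOfStandardType / _isMonoidData` — `C⊢_v` over `𝓑(K_v)⁰ = CosetCat Gal(Ω/K_v)`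
  IS a Frobenioid ([FrdI] Thm. 5.2 (ii), abc-iut-L1-d8 `Datum.isFrobenioid_of_isOfFSMType`) of standard type
  ([FrdII] Thm. 1.2 (i), `Datum.thm12_isOfStandardType_of_isOfFSMType`) with `Φ`, `B` monoids
  (`BadLocalKit.isMonoidData`); input: FSM-type of the coset base ([FrdII] Ex. 1.3 (i), `CosetCat.isOfFSMType`)
  [cite: MochizukiFrdII2008, Ex 1.1 (ii) p.8];
* `BadLocalGroupDatum.thetaDatum_isFrobenioid / _isOfStandardType` — the same for `C^Θ_v` over `D^Θ_v` (FSM-type transported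
  along `prodEquiv`, `IsOfFSMType.of_equivalence`); `isSlim_DTheta` — `D^Θ_v` slim if `𝓑(G_v)⁰` is;
* at the GENUINE datum (`InitialThetaData`, `v ∈ V(F)^bad`, `w ∣ v`): `badCdashAt_isFrobenioid`, `badCdashAt_isOfStandardType`,
  `isSlim_badDdashAt` (`𝓑(K_v̲)⁰` slim: [AbsAnab] Thm. 1.1.1 (ii) for `K_w`, abc-iut-L4's `galoisMLF_slim_holds` through
  `GoodLocalFrobenioid.isSlimGroup_gal_ofPlace`, and abc-iut-L1's `PadicFrd.isSlim_cosetCat_of_isSlimGroup`) — ALL UNCONDITIONAL;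
* **Remark 3.2.2 at the genuine datum** — `nearlyAbsolutelyPrimitive_badCdashAt`: abc-iut-f-194's instance theorem
  `nearlyAbsolutelyPrimitive_badLocalKit` (FACT-LIST F-1314 instance form) read at `D.badCdashAt`: `N·Φ_{C⊢_v̲}` is absolutely
  primitive for some `N > 0` — UNCONDITIONAL.
-/

namespace Literature.IUT.HodgeTheaters

open CategoryTheory Literature.AnabelianGeometry.SemiGraphs Literature.AlgebraicGeometry.Frobenioids
open Literature.AlgebraicGeometry.Frobenioids.PadicFrd Literature.AnabelianGeometry.AbsoluteAnabelian

/-! ### `C⊢_v` over `𝓑(K_v)⁰` -/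

namespace GaloisValDatum

variable {p : ℕ} [Fact p.Prime] (d : GaloisValDatum.{0} p) {q : intNonzero d.k} (hq : ¬ IsUnit q)

/-- **`C⊢_v → F_Φ` IS a Frobenioid** ([FrdI] Thm. 5.2 (ii) for the [FrdII] Ex. 1.1 (ii) datum over the FSM-type base
`𝓑(K_v)⁰`). [claim: Mochizuki2012, status: disputed] -/
theorem dashDatum_isFrobenioid [IsTopologicalGroup d.Gal] :
    PreFrobenioid.IsFrobenioid (d.dashDatum hq).structureFunctor :=
  (d.dashDatum hq).isFrobenioid_of_isOfFSMType CosetCat.isOfFSMType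

/-- **`C⊢_v` is of standard type** ([FrdII] Thm. 1.2 (i)). [claim: Mochizuki2012, status: disputed] -/
theorem dashDatum_isOfStandardType [IsTopologicalGroup d.Gal] :
    (ModelFrobenioid.data (d.dashDatum hq).Φ (d.dashDatum hq).B (d.dashDatum hq).divB).IsOfStandardType :=
  (d.dashDatum hq).thm12_isOfStandardType_of_isOfFSMType CosetCat.isOfFSMType

/-- "`Φ`, `B` are monoids on `D`" for `C⊢_v` ([FrdII] Ex. 1.1 (ii) standing property). [claim: Mochizuki2012, status: disputed] -/
theorem dashDatum_isMonoidData [IsTopologicalGroup d.Gal] : (d.dashDatum hq).IsMonoidData :=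
  BadLocalKit.isMonoidData _ _ _ _ hq CosetCat.isOfFSMType

end GaloisValDatum

/-! ### `C^Θ_v` over `D^Θ_v` -/

namespace BadLocalGroupDatum

variable {p : ℕ} [Fact p.Prime] (d : GaloisValDatum.{0} p) {P : Type} [Group P] [TopologicalSpace P]
  (T : BadLocalGroupDatum d.Gal P) {q : intNonzero d.k} (hq : ¬ IsUnit q)

/-- `D^Θ_v` is of FSM-type (transported from `𝓑(G_v)⁰` along `prodEquiv`). [claim: Mochizuki2012, status: disputed] -/
theorem isOfFSMType_DTheta [IsTopologicalGroup d.Gal] : IsOfFSMType T.DTheta :=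
  IsOfFSMType.of_equivalence T.prodEquiv CosetCat.isOfFSMType

/-- `D^Θ_v` is slim as soon as `𝓑(G_v)⁰` is (transport along `prodEquiv`). [claim: Mochizuki2012, status: disputed] -/
theorem isSlim_DTheta (hslim : IsSlim (CosetCat d.Gal)) : IsSlim T.DTheta := hslim.of_equivalence T.prodEquiv

/-- **`C^Θ_v → F_Φ` IS a Frobenioid** over the FSM-type base `D^Θ_v`. [claim: Mochizuki2012, status: disputed] -/
theorem thetaDatum_isFrobenioid [IsTopologicalGroup d.Gal] :
    PreFrobenioid.IsFrobenioid (T.thetaDatum d hq).structureFunctor :=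
  (T.thetaDatum d hq).isFrobenioid_of_isOfFSMType (T.isOfFSMType_DTheta d)

/-- **`C^Θ_v` is of standard type** ([FrdII] Thm. 1.2 (i)). [claim: Mochizuki2012, status: disputed] -/
theorem thetaDatum_isOfStandardType [IsTopologicalGroup d.Gal] :
    (ModelFrobenioid.data (T.thetaDatum d hq).Φ (T.thetaDatum d hq).B (T.thetaDatum d hq).divB).IsOfStandardType :=
  (T.thetaDatum d hq).thm12_isOfStandardType_of_isOfFSMType (T.isOfFSMType_DTheta d)

/-- "`Φ`, `B` are monoids on `D^Θ_v`" for `C^Θ_v`. [claim: Mochizuki2012, status: disputed] -/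
theorem thetaDatum_isMonoidData [IsTopologicalGroup d.Gal] : (T.thetaDatum d hq).IsMonoidData :=
  BadLocalKit.isMonoidData _ _ _ _ hq (T.isOfFSMType_DTheta d)

end BadLocalGroupDatum

/-! ### At the genuine datum: UNCONDITIONAL -/

namespace InitialThetaData

open NumberField IsDedekindDomain

variable {F K Fbar : Type} [Field F] [NumberField F] [Field K] [NumberField K] [Algebra F K]
  [Field Fbar] [Algebra F Fbar] [Algebra K Fbar] [IsScalarTower F K Fbar] {E : WeierstrassCurve F}
  [E.IsElliptic] {l : ℕ} {Pb : BadPlacePredicates K} (D : InitialThetaData F K Fbar E l Pb)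
  {v : FinitePlace F} (hv : v ∈ D.VFbad) (w : HeightOneSpectrum (𝓞 K)) [w.asIdeal.LiesOver v.maximalIdeal.asIdeal]
  (p : ℕ) [Fact p.Prime] (hw : ((p : ℕ) : 𝓞 K) ∈ w.asIdeal)

/-- **The GENUINE `C⊢_v̲ → F_Φ` IS a Frobenioid** ([FrdI] Thm. 5.2 (ii) / [FrdII] Ex. 1.1 (ii) over `𝓑(K_v̲)⁰`).
[claim: Mochizuki2012, status: disputed] -/
theorem badCdashAt_isFrobenioid :
    PreFrobenioid.IsFrobenioid
      ((GaloisValDatum.ofPlace K p w hw).dashDatum (D.qRootAt_not_isUnit hv w p hw)).structureFunctor :=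
  GaloisValDatum.dashDatum_isFrobenioid _ _

/-- **The GENUINE `C⊢_v̲` is of standard type** ([FrdII] Thm. 1.2 (i)). [claim: Mochizuki2012, status: disputed] -/
theorem badCdashAt_isOfStandardType :
    (ModelFrobenioid.data ((GaloisValDatum.ofPlace K p w hw).dashDatum (D.qRootAt_not_isUnit hv w p hw)).Φ
      ((GaloisValDatum.ofPlace K p w hw).dashDatum (D.qRootAt_not_isUnit hv w p hw)).B
      ((GaloisValDatum.ofPlace K p w hw).dashDatum (D.qRootAt_not_isUnit hv w p hw)).divB).IsOfStandardType :=
  GaloisValDatum.dashDatum_isOfStandardType _ _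

omit [w.asIdeal.LiesOver v.maximalIdeal.asIdeal] in
/-- **`D⊢_v̲ = 𝓑(K_v̲)⁰` IS slim** — [AbsAnab] Thm. 1.1.1 (ii) for the `p`-adic local field `K_w` (abc-iut-L4's
`galoisMLF_slim_holds` via `GoodLocalFrobenioid.isSlimGroup_gal_ofPlace`) and "`Π` slim ⇒ `𝓑(Π)⁰` slim" ([FrdI] §0,
abc-iut-L1's `PadicFrd.isSlim_cosetCat_of_isSlimGroup`) — UNCONDITIONAL. [claim: Mochizuki2012, status: disputed] -/
theorem isSlim_badDdashAt : IsSlim (CosetCat (GaloisValDatum.ofPlace K p w hw).Gal) :=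
  PadicFrd.isSlim_cosetCat_of_isSlimGroup (GoodLocalFrobenioid.isSlimGroup_gal_ofPlace K p w hw)

/-- `D^Θ_v̲` of the genuine datum is slim, for every group datum `T`. [claim: Mochizuki2012, status: disputed] -/
theorem isSlim_badDThetaAt {P : Type} [Group P] [TopologicalSpace P]
    (T : BadLocalGroupDatum (GaloisValDatum.ofPlace K p w hw).Gal P) : IsSlim T.DTheta :=
  T.isSlim_DTheta (GaloisValDatum.ofPlace K p w hw) (isSlim_badDdashAt w p hw)

/-- **Remark 3.2.2 at the GENUINE `C⊢_v̲`** — "there exists a positive integer `N` such that `N·Φ_{C⊢_v}` is absolutely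
primitive": abc-iut-f-194's instance theorem `nearlyAbsolutelyPrimitive_badLocalKit` (FACT-LIST F-1314 instance form) read
at `D.badCdashAt` — UNCONDITIONAL. [claim: Mochizuki2012, status: disputed] -/
theorem nearlyAbsolutelyPrimitive_badCdashAt :
    NearlyAbsolutelyPrimitive (Obj := CosetCat (GaloisValDatum.ofPlace K p w hw).Gal)
      (fun A => MonoidHom.mrange
        (((GaloisValDatum.ofPlace K p w hw).dashDatum (D.qRootAt_not_isUnit hv w p hw)).phiGp A))
      (fun A => (((GaloisValDatum.ofPlace K p w hw).dashDatum (D.qRootAt_not_isUnit hv w p hw)).ordQpSubgroup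
        A).toSubmonoid) :=
  nearlyAbsolutelyPrimitive_badLocalKit _ _ _ _ (D.qRootAt_not_isUnit hv w p hw)

end InitialThetaData

end Literature.IUT.HodgeTheaters
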